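import Mathlib
import HarnessLib

/-! # Stub `helper_monotoneTauberian` of line `Sketch` (crux `EntropyRung.ConicalGap`, stmt-SmoothPoincare4-16589)

Pure real analysis (cycle 5, localisation to sublevel sets): the elementary monotone-density
Tauberian step. If `V : ℝ → ℝ` is monotone and the normalised primitive
`A(t)/t³ = (∫₀ᵗ V)/t³` tends to `α` as `t → ∞`, then `V(t)/t² → 3α`.

How. `V` monotone, so every interval integral exists (`Monotone.intervalIntegrable`) and
`A(t') − A(t) = ∫_t^{t'} V` (`intervalIntegral.integral_interval_sub_left`). For `0 < ε` (`< 1`)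
and `t > 0`, monotonicity gives `ε t · V t ≤ A((1+ε)t) − A(t)` and `A(t) − A((1−ε)t) ≤ ε t · V t`,
whence the two difference-quotient bounds
`[A(t)/t³ − (1−ε)³ A((1−ε)t)/((1−ε)t)³]/ε ≤ V t/t² ≤ [(1+ε)³ A((1+ε)t)/((1+ε)t)³ − A(t)/t³]/ε`,
whose limits as `t → ∞` are `α(1 − (1−ε)³)/ε` and `α((1+ε)³ − 1)/ε`; both tend to `3α` as
`ε → 0⁺`, and an order squeeze (`tendsto_order`) concludes. No sign assumption on `α` is needed.

Everything here is proved; no definition and no named fact is introduced.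
-/

noncomputable section

set_option linter.dupNamespace false

open scoped Topology
open MeasureTheory Set Filter

namespace Summit.SmoothPoincare4.SmoothPoincare4.Theorems.ConicalGapSketch

/-- A monotone function dominates its left endpoint value: `(b - a) V a ≤ ∫_a^b V`. -/
theorem monotoneTauberian_integral_ge_left {V : ℝ → ℝ} (hV : Monotone V) {a b : ℝ}
    (hab : a ≤ b) : (b - a) * V a ≤ ∫ x in a..b, V x := by
  have h : (∫ _ in a..b, V a) ≤ ∫ x in a..b, V x :=
    intervalIntegral.integral_mono_on hab intervalIntegrable_const hV.intervalIntegrable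
      fun x hx ↦ hV hx.1
  rwa [intervalIntegral.integral_const, smul_eq_mul] at h

/-- A monotone function is dominated by its right endpoint value: `∫_a^b V ≤ (b - a) V b`. -/
theorem monotoneTauberian_integral_le_right {V : ℝ → ℝ} (hV : Monotone V) {a b : ℝ}
    (hab : a ≤ b) : ∫ x in a..b, V x ≤ (b - a) * V b := by
  have h : (∫ x in a..b, V x) ≤ ∫ _ in a..b, V b :=
    intervalIntegral.integral_mono_on hab hV.intervalIntegrable intervalIntegrable_const
      fun x hx ↦ hV hx.2
  rwa [intervalIntegral.integral_const, smul_eq_mul] at h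

/-- Differences of the primitive of a monotone function are interval integrals. -/
theorem monotoneTauberian_prim_sub {V : ℝ → ℝ} (hV : Monotone V) (a b : ℝ) :
    (∫ x in (0 : ℝ)..b, V x) - ∫ x in (0 : ℝ)..a, V x = ∫ x in a..b, V x :=
  intervalIntegral.integral_interval_sub_left hV.intervalIntegrable hV.intervalIntegrable

/-- Upper difference-quotient bound: for `t > 0` and `ε > 0`,
`V t / t² ≤ [(1+ε)³ · A((1+ε)t)/((1+ε)t)³ − A(t)/t³] / ε`. -/
theorem monotoneTauberian_upper_bound {V : ℝ → ℝ} (hV : Monotone V) {ε t : ℝ} (hε : 0 < ε)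
    (ht : 0 < t) :
    V t / t ^ 2 ≤
      ((1 + ε) ^ 3 * ((∫ s in (0 : ℝ)..((1 + ε) * t), V s) / ((1 + ε) * t) ^ 3)
        - (∫ s in (0 : ℝ)..t, V s) / t ^ 3) / ε := by
  have hε1 : (0 : ℝ) < 1 + ε := by linarith
  have hkey : ε * t * V t ≤ (∫ s in (0 : ℝ)..((1 + ε) * t), V s) - ∫ s in (0 : ℝ)..t, V s := by
    rw [monotoneTauberian_prim_sub hV]
    calc ε * t * V t = ((1 + ε) * t - t) * V t := by ring
      _ ≤ _ := monotoneTauberian_integral_ge_left hV (by nlinarith)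
  have hR : ((1 + ε) ^ 3 * ((∫ s in (0 : ℝ)..((1 + ε) * t), V s) / ((1 + ε) * t) ^ 3)
        - (∫ s in (0 : ℝ)..t, V s) / t ^ 3) / ε
      = ((∫ s in (0 : ℝ)..((1 + ε) * t), V s) - ∫ s in (0 : ℝ)..t, V s) / (ε * t ^ 3) := by
    field_simp
  have hL : V t / t ^ 2 = ε * t * V t / (ε * t ^ 3) := by
    rw [div_eq_div_iff (by positivity) (by positivity)]
    ring
  rw [hR, hL]
  exact div_le_div_of_nonneg_right hkey (by positivity)

/-- Lower difference-quotient bound: for `t > 0` and `0 < ε < 1`,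
`[A(t)/t³ − (1−ε)³ · A((1−ε)t)/((1−ε)t)³] / ε ≤ V t / t²`. -/
theorem monotoneTauberian_lower_bound {V : ℝ → ℝ} (hV : Monotone V) {ε t : ℝ} (hε : 0 < ε)
    (hε1 : ε < 1) (ht : 0 < t) :
    ((∫ s in (0 : ℝ)..t, V s) / t ^ 3
        - (1 - ε) ^ 3 * ((∫ s in (0 : ℝ)..((1 - ε) * t), V s) / ((1 - ε) * t) ^ 3)) / ε
      ≤ V t / t ^ 2 := by
  have hε2 : (0 : ℝ) < 1 - ε := by linarith
  have hkey : (∫ s in (0 : ℝ)..t, V s) - ∫ s in (0 : ℝ)..((1 - ε) * t), V s ≤ ε * t * V t := by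
    rw [monotoneTauberian_prim_sub hV]
    calc _ ≤ (t - (1 - ε) * t) * V t := monotoneTauberian_integral_le_right hV (by nlinarith)
      _ = ε * t * V t := by ring
  have hR : ((∫ s in (0 : ℝ)..t, V s) / t ^ 3
        - (1 - ε) ^ 3 * ((∫ s in (0 : ℝ)..((1 - ε) * t), V s) / ((1 - ε) * t) ^ 3)) / ε
      = ((∫ s in (0 : ℝ)..t, V s) - ∫ s in (0 : ℝ)..((1 - ε) * t), V s) / (ε * t ^ 3) := by
    field_simp
  have hL : V t / t ^ 2 = ε * t * V t / (ε * t ^ 3) := by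
    rw [div_eq_div_iff (by positivity) (by positivity)]
    ring
  rw [hR, hL]
  exact div_le_div_of_nonneg_right hkey (by positivity)

/-- Limit of the upper difference quotient as `t → ∞`, for fixed `ε > -1`. -/
theorem monotoneTauberian_upper_tendsto {V : ℝ → ℝ} {α : ℝ}
    (hA : Tendsto (fun t : ℝ ↦ (∫ s in (0 : ℝ)..t, V s) / t ^ 3) atTop (𝓝 α)) {ε : ℝ}
    (hε : 0 < ε) :
    Tendsto (fun t : ℝ ↦ ((1 + ε) ^ 3 * ((∫ s in (0 : ℝ)..((1 + ε) * t), V s) / ((1 + ε) * t) ^ 3)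
        - (∫ s in (0 : ℝ)..t, V s) / t ^ 3) / ε) atTop (𝓝 (((1 + ε) ^ 3 * α - α) / ε)) := by
  have h1 : Tendsto (fun t : ℝ ↦ (∫ s in (0 : ℝ)..((1 + ε) * t), V s) / ((1 + ε) * t) ^ 3)
      atTop (𝓝 α) :=
    hA.comp (tendsto_id.const_mul_atTop (by linarith : (0 : ℝ) < 1 + ε))
  exact ((h1.const_mul _).sub hA).div_const ε

/-- Limit of the lower difference quotient as `t → ∞`, for fixed `ε < 1`. -/
theorem monotoneTauberian_lower_tendsto {V : ℝ → ℝ} {α : ℝ}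
    (hA : Tendsto (fun t : ℝ ↦ (∫ s in (0 : ℝ)..t, V s) / t ^ 3) atTop (𝓝 α)) {ε : ℝ}
    (hε1 : ε < 1) :
    Tendsto (fun t : ℝ ↦ ((∫ s in (0 : ℝ)..t, V s) / t ^ 3
        - (1 - ε) ^ 3 * ((∫ s in (0 : ℝ)..((1 - ε) * t), V s) / ((1 - ε) * t) ^ 3)) / ε)
      atTop (𝓝 ((α - (1 - ε) ^ 3 * α) / ε)) := by
  have h1 : Tendsto (fun t : ℝ ↦ (∫ s in (0 : ℝ)..((1 - ε) * t), V s) / ((1 - ε) * t) ^ 3)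
      atTop (𝓝 α) :=
    hA.comp (tendsto_id.const_mul_atTop (by linarith : (0 : ℝ) < 1 - ε))
  exact (hA.sub (h1.const_mul _)).div_const ε

/-- The upper limiting value `α((1+ε)³ − 1)/ε = α(3 + 3ε + ε²)` tends to `3α` as `ε → 0⁺`. -/
theorem monotoneTauberian_eps_upper (α : ℝ) :
    Tendsto (fun ε : ℝ ↦ ((1 + ε) ^ 3 * α - α) / ε) (𝓝[>] 0) (𝓝 (3 * α)) := by
  have hcont : Tendsto (fun ε : ℝ ↦ α * (3 + 3 * ε + ε ^ 2)) (𝓝 0) (𝓝 (3 * α)) :=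
    (by fun_prop : Continuous fun ε : ℝ ↦ α * (3 + 3 * ε + ε ^ 2)).tendsto' 0 (3 * α) (by ring)
  refine Tendsto.congr' ?_ (hcont.mono_left nhdsWithin_le_nhds)
  filter_upwards [self_mem_nhdsWithin] with ε hε
  rw [eq_div_iff (ne_of_gt hε)]
  ring

/-- The lower limiting value `α(1 − (1−ε)³)/ε = α(3 − 3ε + ε²)` tends to `3α` as `ε → 0⁺`. -/
theorem monotoneTauberian_eps_lower (α : ℝ) :
    Tendsto (fun ε : ℝ ↦ (α - (1 - ε) ^ 3 * α) / ε) (𝓝[>] 0) (𝓝 (3 * α)) := by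
  have hcont : Tendsto (fun ε : ℝ ↦ α * (3 - 3 * ε + ε ^ 2)) (𝓝 0) (𝓝 (3 * α)) :=
    (by fun_prop : Continuous fun ε : ℝ ↦ α * (3 - 3 * ε + ε ^ 2)).tendsto' 0 (3 * α) (by ring)
  refine Tendsto.congr' ?_ (hcont.mono_left nhdsWithin_le_nhds)
  filter_upwards [self_mem_nhdsWithin] with ε hε
  rw [eq_div_iff (ne_of_gt hε)]
  ring

/-- **Stub `helper_monotoneTauberian` (MT) of line `Sketch`.** Monotone-density Tauberian step:
if `V : ℝ → ℝ` is monotone and `(∫₀ᵗ V)/t³ → α` as `t → ∞`, then `V t/t² → 3α`. Applied to the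
sublevel volume profile of a complete gradient shrinking Ricci soliton in dimension `4`, it gives the
existence of the asymptotic volume ratio `lim V(t)/t²`. -/
theorem helper_monotoneTauberian : ∀ (V : ℝ → ℝ) (α : ℝ), Monotone V → Filter.Tendsto (fun t : ℝ ↦ (∫ s in (0 : ℝ)..t, V s) / t ^ 3) Filter.atTop (nhds α) → Filter.Tendsto (fun t : ℝ ↦ V t / t ^ 2) Filter.atTop (nhds (3 * α)) := by
  intro V α hV hA
  rw [tendsto_order]
  refine ⟨fun b hb ↦ ?_, fun b hb ↦ ?_⟩
  · obtain ⟨ε, hε0, hε1, hεb⟩ : ∃ ε : ℝ, 0 < ε ∧ ε < 1 ∧ b < (α - (1 - ε) ^ 3 * α) / ε := by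
      have h1 : ∀ᶠ ε in 𝓝[>] (0 : ℝ), 0 < ε := self_mem_nhdsWithin
      have h2 : ∀ᶠ ε in 𝓝[>] (0 : ℝ), ε < 1 :=
        (eventually_lt_nhds (by norm_num : (0 : ℝ) < 1)).filter_mono nhdsWithin_le_nhds
      have h3 : ∀ᶠ ε in 𝓝[>] (0 : ℝ), b < (α - (1 - ε) ^ 3 * α) / ε :=
        (monotoneTauberian_eps_lower α).eventually_const_lt hb
      exact (h1.and (h2.and h3)).exists
    filter_upwards [(monotoneTauberian_lower_tendsto hA hε1).eventually_const_lt hεb,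
      eventually_gt_atTop 0] with t ht1 ht2
    exact lt_of_lt_of_le ht1 (monotoneTauberian_lower_bound hV hε0 hε1 ht2)
  · obtain ⟨ε, hε0, hεb⟩ : ∃ ε : ℝ, 0 < ε ∧ ((1 + ε) ^ 3 * α - α) / ε < b := by
      have h1 : ∀ᶠ ε in 𝓝[>] (0 : ℝ), 0 < ε := self_mem_nhdsWithin
      have h3 : ∀ᶠ ε in 𝓝[>] (0 : ℝ), ((1 + ε) ^ 3 * α - α) / ε < b :=
        (monotoneTauberian_eps_upper α).eventually_lt_const hb
      exact (h1.and h3).exists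
    filter_upwards [(monotoneTauberian_upper_tendsto hA hε0).eventually_lt_const hεb,
      eventually_gt_atTop 0] with t ht1 ht2
    exact lt_of_le_of_lt (monotoneTauberian_upper_bound hV hε0 ht2) ht1

end Summit.SmoothPoincare4.SmoothPoincare4.Theorems.ConicalGapSketch

end
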